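import Summits.BirchSwinnertonDyer.BirchSwinnertonDyer.Theorems.CMKolyvaginAtInertTwoShaCountCMInertRamifiedAtTwo
import Summits.BirchSwinnertonDyer.BirchSwinnertonDyer.Theorems.CMKolyvaginAtInertTwoShaCountJacobiCompositeAtTwo
import Literature.NumberTheory.EllipticCurves.HeegnerHypothesisKroneckerProofs
import HarnessLib

/-!
# Route `CMKolyvaginAtInertTwo`, crux HL′ (stmt-BirchSwinnertonDyer-28663): GENUS PARITY ON H₂ —
# the three stubs (F1)–(F3) of the pen's `GenusParity_preview.lean` (HLPRIME-ATTACK-MEMO §1, P-HL2), PROVED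

Seat `bsd-line-cmk2-p1` g22 (cell `bsd-print-cf2`), `--supports stmt-BirchSwinnertonDyer-28663` (helper; closes nothing by name — the
pen may file these as the first stubs of an HL′ line, closers below).  THEOREMS ONLY (no definition, no named fact, no `sorry`).  BSD and
HL′ are NOT proved by this.

* `genusParityOnHTwo` — (F3) Σ-form: on H₂ (CM, `2` inert in the CM field `F`, `ρ̄_{E,2}` onto) every imaginary quadratic `K` with odd
  `d_K` and the Heegner hypothesis has genus defect `Σ_E(d_K) ≥ 1`.  ONE LINE from g15 (`ShaCountTwo.one_le_sum_defect_of_Δ_neg_of_heegner`,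
  `Δ < 0` by `KolyvaginEigenTwo.Δ_neg_of_cmInert_two`).
* `jacobiSym_num_Δ_eq_jacobiSym_cmFieldDiscr` — (F2) square class: for an odd prime `q ∤ N_E`, `(Δ_E/q) = (d_F/q)` (`Δ_E = d_F·s²`,
  `KolyvaginFrobeniusTwo.exists_Δ_eq_cmFieldDiscr_mul_sq_of_cmInert_two`; numerator and denominator of `s` are units mod `q` since
  `q ∤ Δ_min` (good reduction) and `q ≠ |d_F|` (`|d_F| ∣ N_E`)); `discSquareClassOnHTwo` = the pen's typed form.
* `jacobiSym_cmFieldDiscr_natAbs_discr_eq_neg_one` — `(d_F / |d_K|) = −1` by RECIPROCITY ALONE (no `ρ̄₂` hypothesis): `d_F = −ℓ`,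
  `ℓ ≡ 3 (4)` prime, `ℓ ∣ N_E` splits in `K` so `(d_K/ℓ) = 1`; `|d_K| ≡ 3 (4)`; `(−ℓ/|d_K|) = −(ℓ/|d_K|) = (|d_K|/ℓ) = −(d_K/ℓ)·… = −1`.
* `oddInertCountOnHTwo` — (F3) counting form: an ODD number of prime factors `q` of `d_K` have `(d_F/q) = −1` (are inert in `F`):
  `(d_F/|d_K|) = ∏_{q ∣ d_K} (d_F/q)` (`|d_K|` square-free) and each factor is `±1`.

References: [GrossLMS1991] §2 (Heegner hypothesis); [Kramer1981] Prop. 3; [SilvermanATAEC1994] App. A §3; Ireland–Rosen §5.2 (Jacobi symbol).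
-/

set_option autoImplicit false
-- the Theorems namespace of this sub repeats the summit name by design (D-0017 nested layout)
set_option linter.dupNamespace false

noncomputable section

open scoped Classical

open WeierstrassCurve NumberField Literature.NumberTheory.EllipticCurves
  Literature.NumberTheory.EllipticCurves.Rank1Residual

namespace Summit.BirchSwinnertonDyer.BirchSwinnertonDyer.Theorems.GenusParityTwo

/-! ## §1 (F3), Σ-form -/

/-- **Genus parity on H₂, Σ-form**: for `W/ℚ` globally minimal with CM, `2` inert in the CM field and `ρ̄_{E,2}` onto, every imaginary
quadratic `K` with odd `d_K` satisfying the Heegner hypothesis for `N_W` has genus defect `Σ_W(d_K) ≥ 1` (`Δ < 0` on H₂, and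
`(Δ_min/|d_K|) = −1` forces some `(Δ/q) = −1`).  The pen's `GenusParityOnHTwo`, verbatim. [cite: Kramer1981, Prop. 3] -/
theorem genusParityOnHTwo :
    ∀ (W : WeierstrassCurve ℚ) [W.IsElliptic] [W.IsGloballyMinimal] [NeZero (W.conductorNorm ℤ)],
      W.HasCM → CMInert W 2 → W.HasSurjectiveModNGaloisRep (2 : ℤ) →
      ∀ (K : Type) [Field K] [NumberField K], IsImaginaryQuadratic K → Odd (NumberField.discr K) →
        SatisfiesHeegnerHypothesis (W.conductorNorm ℤ) K →
        1 ≤ ∑ q ∈ (NumberField.discr K).natAbs.primeFactors,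
              ((if jacobiSym W.Δ.num q = -1 then 1 else 0) +
               (if jacobiSym W.Δ.num q = 1 ∧ Even (W.frobeniusTrace q) then 2 else 0)) := by
  intro W _ _ _ hCM hin hρ K _ _ hK hodd hH
  exact ShaCountTwo.one_le_sum_defect_of_Δ_neg_of_heegner W K hK hodd hH (KolyvaginEigenTwo.Δ_neg_of_cmInert_two W hCM hin hρ)

/-! ## §2 (F2), the square class of `Δ` -/

/-- **`(Δ_E/q) = (d_F/q)` for a prime `q ∤ N_E`** on H₂ (no parity condition on `q` is needed) (`W/ℚ` globally minimal with CM, `2` inert in `F`, `ρ̄_{E,2}` onto):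
`Δ_E = d_F·s²` (`s ∈ ℚ`), `q ∤ Δ_min` (good reduction at `q ∤ N_E`) and `q ≠ |d_F|` (`|d_F| ∣ N_E`), so `num(s)`, `den(s)` are units
mod `q` and `Δ_min ≡ d_F·(unit)²`; both symbols are Legendre symbols at the prime `q`.
[cite: SilvermanATAEC1994, App. A §3 (table of CM j-invariants)] [cite: Kramer1981, Prop. 3] -/
theorem jacobiSym_num_Δ_eq_jacobiSym_cmFieldDiscr (W : WeierstrassCurve ℚ) [W.IsElliptic] [W.IsGloballyMinimal]
    (hCM : W.HasCM) (hin : CMInert W 2) (hsurj : W.HasSurjectiveModNGaloisRep 2)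
    {q : ℕ} (hq : q.Prime) (hqN : ¬ q ∣ W.conductorNorm ℤ) :
    jacobiSym W.Δ.num q = jacobiSym (cmFieldDiscrOfJ W.j) q := by
  haveI : Fact q.Prime := ⟨hq⟩
  obtain ⟨-, s, hs⟩ := KolyvaginFrobeniusTwo.exists_Δ_eq_cmFieldDiscr_mul_sq_of_cmInert_two W hCM hin hsurj
  set d : ℤ := cmFieldDiscrOfJ W.j with hd_def
  -- `q` is good, so `q ∤ Δ_min`; `q ≠ ℓ = |d_F|` since `ℓ ∣ N`, so `q ∤ d_F`
  have hgood : W.HasGoodReductionAtPrime q := by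
    by_contra hbad
    exact hqN ((W.dvd_conductorNorm_iff_not_hasGoodReductionAtPrime q).mpr hbad)
  obtain ⟨hℓP, -, hdℓ⟩ := ShaCountTwo.prime_natAbs_cmFieldDiscr_of_cmInert_two W hin
  have hℓN := ShaCountTwo.natAbs_cmFieldDiscr_dvd_conductorNorm W hCM hin hsurj
  have hqd : ¬ (q : ℤ) ∣ d := by
    intro h
    have h' : q ∣ d.natAbs := Int.natCast_dvd.mp h
    have hqℓ : q = d.natAbs := (Nat.prime_dvd_prime_iff_eq hq hℓP).mp h'
    exact hqN (hqℓ ▸ hℓN)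
  set Δm : ℤ := minimalDiscriminantInt W with hΔm_def
  have hcast : (Δm : ℚ) = W.Δ := cast_minimalDiscriminantInt W
  have hnum : W.Δ.num = Δm := by rw [← hcast, Rat.num_intCast]
  have hqΔ : ¬ (q : ℤ) ∣ Δm := not_dvd_minimalDiscriminantInt_of_hasGoodReductionAtPrime' W q hgood
  -- clear denominators: `Δ_min · den(s)² = d_F · num(s)²`
  have hsq : (Δm : ℚ) * (s.den : ℚ) ^ 2 = (d : ℚ) * (s.num : ℚ) ^ 2 := by
    have h1 : (s.num : ℚ) = s * s.den := (Rat.mul_den_eq_num s).symm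
    rw [hcast, hs, h1]
    ring
  have hZ : Δm * (s.den : ℤ) ^ 2 = d * s.num ^ 2 := by exact_mod_cast hsq
  have hmod : (Δm : ZMod q) * ((s.den : ℤ) : ZMod q) ^ 2 = (d : ZMod q) * ((s.num : ℤ) : ZMod q) ^ 2 := by
    have := congrArg (Int.cast : ℤ → ZMod q) hZ
    push_cast at this ⊢
    exact this
  have hΔ0 : ((Δm : ℤ) : ZMod q) ≠ 0 := by
    rw [Ne, ZMod.intCast_zmod_eq_zero_iff_dvd]; exact hqΔ
  have hd0 : ((d : ℤ) : ZMod q) ≠ 0 := by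
    rw [Ne, ZMod.intCast_zmod_eq_zero_iff_dvd]; exact hqd
  have hden : ((s.den : ℤ) : ZMod q) ≠ 0 := by
    intro h0
    have hqden : (q : ℤ) ∣ (s.den : ℤ) := (ZMod.intCast_zmod_eq_zero_iff_dvd _ _).mp h0
    have h2 : (d : ZMod q) * ((s.num : ℤ) : ZMod q) ^ 2 = 0 := by
      rw [← hmod, h0]; ring
    rcases mul_eq_zero.mp h2 with h | h
    · exact hd0 h
    · have hnum0 : ((s.num : ℤ) : ZMod q) = 0 := pow_eq_zero_iff (two_ne_zero) |>.mp h
      have hqnum : (q : ℤ) ∣ s.num := (ZMod.intCast_zmod_eq_zero_iff_dvd _ _).mp hnum0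
      have hqnum' : q ∣ s.num.natAbs := Int.natCast_dvd.mp hqnum
      have hqden' : q ∣ s.den := by exact_mod_cast hqden
      have h1 : q ∣ Nat.gcd s.num.natAbs s.den := Nat.dvd_gcd hqnum' hqden'
      rw [s.reduced.gcd_eq_one] at h1
      exact hq.one_lt.ne' (Nat.dvd_one.mp h1)
  have hnum0 : ((s.num : ℤ) : ZMod q) ≠ 0 := by
    intro h0
    have : (Δm : ZMod q) * ((s.den : ℤ) : ZMod q) ^ 2 = 0 := by rw [hmod, h0]; ring
    rcases mul_eq_zero.mp this with h | h
    · exact hΔ0 h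
    · exact hden (pow_eq_zero_iff two_ne_zero |>.mp h)
  -- `Δ_min` is a square mod `q` iff `d_F` is
  have hiff : IsSquare ((Δm : ℤ) : ZMod q) ↔ IsSquare ((d : ℤ) : ZMod q) := by
    constructor
    · rintro ⟨r, hr⟩
      refine ⟨r * ((s.den : ℤ) : ZMod q) * (((s.num : ℤ) : ZMod q))⁻¹, ?_⟩
      have key : (d : ZMod q) = (Δm : ZMod q) * ((s.den : ℤ) : ZMod q) ^ 2 * ((((s.num : ℤ) : ZMod q)) ^ 2)⁻¹ := by
        rw [hmod, mul_assoc, mul_inv_cancel₀ (pow_ne_zero 2 hnum0), mul_one]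
      rw [key, hr]
      field_simp
    · rintro ⟨r, hr⟩
      refine ⟨r * ((s.num : ℤ) : ZMod q) * (((s.den : ℤ) : ZMod q))⁻¹, ?_⟩
      have key : (Δm : ZMod q) = (d : ZMod q) * ((s.num : ℤ) : ZMod q) ^ 2 * ((((s.den : ℤ) : ZMod q)) ^ 2)⁻¹ := by
        rw [← hmod, mul_assoc, mul_inv_cancel₀ (pow_ne_zero 2 hden), mul_one]
      rw [key, hr]
      field_simp
  -- both are Legendre symbols at the prime `q`
  rw [hnum, ← jacobiSym.legendreSym.to_jacobiSym, ← jacobiSym.legendreSym.to_jacobiSym]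
  by_cases hsqd : IsSquare ((d : ℤ) : ZMod q)
  · rw [(legendreSym.eq_one_iff q hd0).mpr hsqd, (legendreSym.eq_one_iff q hΔ0).mpr (hiff.mpr hsqd)]
  · rw [(legendreSym.eq_neg_one_iff q).mpr hsqd, (legendreSym.eq_neg_one_iff q).mpr (fun h ↦ hsqd (hiff.mp h))]

/-- **The pen's `DiscSquareClassOnHTwo`, verbatim.** [cite: SilvermanATAEC1994, App. A §3 (table of CM j-invariants)] -/
theorem discSquareClassOnHTwo :
    ∀ (W : WeierstrassCurve ℚ) [W.IsElliptic] [W.IsGloballyMinimal],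
      W.HasCM → CMInert W 2 → W.HasSurjectiveModNGaloisRep (2 : ℤ) →
      ∀ q : ℕ, q.Prime → q ≠ 2 → ¬ (q ∣ W.conductorNorm ℤ) →
        jacobiSym W.Δ.num q = jacobiSym (cmFieldDiscrOfJ W.j) q := by
  intro W _ _ hCM hin hρ q hq _ hqN
  exact jacobiSym_num_Δ_eq_jacobiSym_cmFieldDiscr W hCM hin hρ hq hqN

/-! ## §3 (F3), counting form — by reciprocity -/

/-- **Jacobi multiplicativity over the prime factors of a square-free modulus**: `J(a | b) = ∏_{q ∣ b} J(a | q)`. [folklore] -/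
theorem jacobiSym_eq_prod_primeFactors_of_squarefree (a : ℤ) {b : ℕ} (hb : Squarefree b) :
    jacobiSym a b = ∏ q ∈ b.primeFactors, jacobiSym a q := by
  have key : ∀ s : Finset ℕ, (∀ q ∈ s, q ≠ 0) → jacobiSym a (∏ q ∈ s, q) = ∏ q ∈ s, jacobiSym a q := by
    intro s
    refine Finset.induction_on s (fun _ ↦ by simp [jacobiSym.one_right]) (fun q s hqs ih hs ↦ ?_)
    rw [Finset.prod_insert hqs, Finset.prod_insert hqs]
    have hq0 : q ≠ 0 := hs q (Finset.mem_insert_self q s)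
    have hs0 : ∀ x ∈ s, x ≠ 0 := fun x hx ↦ hs x (Finset.mem_insert_of_mem hx)
    have hprod0 : ∏ x ∈ s, x ≠ 0 := Finset.prod_ne_zero_iff.mpr hs0
    rw [jacobiSym.mul_right' a hq0 hprod0, ih hs0]
  conv_lhs => rw [← Nat.prod_primeFactors_of_squarefree hb]
  exact key _ (fun q hq ↦ (Nat.prime_of_mem_primeFactors hq).ne_zero)

/-- **`(d_F / |d_K|) = −1` on H₂, by reciprocity**: `W/ℚ` globally minimal with CM and `2` inert in `F` (`d_F = −ℓ`, `ℓ ≡ 3 (mod 4)`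
prime); `K` imaginary quadratic with odd `d_K` (so `|d_K| ≡ 3 (mod 4)`) and the Heegner hypothesis for `N_W`; `ρ̄_{W,2}` onto (used
only for `ℓ ∣ N_W`).  Then `ℓ` splits in `K`, `(d_K/ℓ) = 1`, and `(−ℓ/|d_K|) = −(ℓ/|d_K|) = (|d_K|/ℓ) = −(d_K/ℓ)… = −1`.
[cite: GrossLMS1991, §2 (Heegner hypothesis)] -/
theorem jacobiSym_cmFieldDiscr_natAbs_discr_eq_neg_one (W : WeierstrassCurve ℚ) [W.IsElliptic] [W.IsGloballyMinimal]
    (hCM : W.HasCM) (hin : CMInert W 2) (hsurj : W.HasSurjectiveModNGaloisRep 2)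
    (K : Type) [Field K] [NumberField K] (hK : IsImaginaryQuadratic K) (hodd : Odd (NumberField.discr K))
    (hH : SatisfiesHeegnerHypothesis (W.conductorNorm ℤ) K) :
    jacobiSym (cmFieldDiscrOfJ W.j) (NumberField.discr K).natAbs = -1 := by
  obtain ⟨hℓP, hℓ4, hdℓ⟩ := ShaCountTwo.prime_natAbs_cmFieldDiscr_of_cmInert_two W hin
  have hℓN := ShaCountTwo.natAbs_cmFieldDiscr_dvd_conductorNorm W hCM hin hsurj
  set ℓ : ℕ := (cmFieldDiscrOfJ W.j).natAbs with hℓ_def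
  set D : ℤ := NumberField.discr K with hD_def
  have hDneg : D < 0 := IsImaginaryQuadratic.discr_neg hK
  have hD4 : D % 4 = 1 := Literature.NumberTheory.QuadraticFields.Quadratic.discr_emod_four_eq_one hK.1 hodd
  have hDabs : (D.natAbs : ℤ) = -D := by omega
  have hm4 : D.natAbs % 4 = 3 := by omega
  have hℓ2 : ℓ ≠ 2 := by omega
  -- `(d_K / ℓ) = 1`: `ℓ ∣ N` splits in `K`
  have hkr := ((satisfiesHeegnerHypothesis_iff_kronecker (W.conductorNorm ℤ) K hK.1).mp hH ℓ hℓP hℓN).2 hℓ2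
  -- reciprocity
  have hrec : jacobiSym (ℓ : ℤ) D.natAbs = -jacobiSym (D.natAbs : ℤ) ℓ :=
    jacobiSym.quadratic_reciprocity_three_mod_four hℓ4 hm4
  have hDℓ : jacobiSym (D.natAbs : ℤ) ℓ = -1 := by
    rw [hDabs, jacobiSym.neg _ (Nat.odd_iff.mpr (by omega)), ZMod.χ₄_nat_three_mod_four hℓ4, hkr]
    norm_num
  rw [hdℓ, jacobiSym.neg _ (Nat.odd_iff.mpr (by omega)), ZMod.χ₄_nat_three_mod_four hm4, hrec, hDℓ]
  norm_num

/-- **Genus parity on H₂, counting form: an ODD number of prime factors of `d_K` are inert in `F`** (`(d_F/q) = −1`), for `W/ℚ`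
globally minimal with CM, `2` inert in `F`, `ρ̄_{W,2}` onto, and `K` imaginary quadratic with odd `d_K` and the Heegner hypothesis:
`∏_{q ∣ d_K} (d_F/q) = (d_F/|d_K|) = −1` with every factor `±1` (`q ≠ ℓ` since `ℓ ∣ N_W` splits in `K`).
The pen's `OddInertCountOnHTwo` (with the habitat's `ρ̄₂`-onto binder). [cite: GrossLMS1991, §2 (Heegner hypothesis)] -/
theorem oddInertCountOnHTwo (W : WeierstrassCurve ℚ) [W.IsElliptic] [W.IsGloballyMinimal]
    (hCM : W.HasCM) (hin : CMInert W 2) (hsurj : W.HasSurjectiveModNGaloisRep 2)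
    (K : Type) [Field K] [NumberField K] (hK : IsImaginaryQuadratic K) (hodd : Odd (NumberField.discr K))
    (hH : SatisfiesHeegnerHypothesis (W.conductorNorm ℤ) K) :
    Odd (((NumberField.discr K).natAbs.primeFactors.filter
      (fun q => jacobiSym (cmFieldDiscrOfJ W.j) q = -1)).card) := by
  obtain ⟨hℓP, hℓ4, hdℓ⟩ := ShaCountTwo.prime_natAbs_cmFieldDiscr_of_cmInert_two W hin
  have hℓN := ShaCountTwo.natAbs_cmFieldDiscr_dvd_conductorNorm W hCM hin hsurj
  set d : ℤ := cmFieldDiscrOfJ W.j with hd_def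
  set D : ℤ := NumberField.discr K with hD_def
  set S := D.natAbs.primeFactors with hS_def
  -- `|d_K|` is square-free (odd fundamental discriminant)
  have hsqf : Squarefree D.natAbs := by
    rcases Literature.NumberTheory.QuadraticFields.Quadratic.isFundamentalDiscriminant_discr hK.1 with ⟨-, hsq, -⟩ | ⟨h4, -, -⟩
    · exact Int.squarefree_natAbs.mpr hsq
    · exfalso
      rw [Int.odd_iff] at hodd
      omega
  have hprod : ∏ q ∈ S, jacobiSym d q = -1 := by
    rw [← jacobiSym_eq_prod_primeFactors_of_squarefree d hsqf]
    exact jacobiSym_cmFieldDiscr_natAbs_discr_eq_neg_one W hCM hin hsurj K hK hodd hH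
  -- every factor is `±1`: `q ∣ d_K` is prime to `N ⊇ {ℓ}`, so `q ∤ d_F = −ℓ`
  have hpm : ∀ q ∈ S, jacobiSym d q = 1 ∨ jacobiSym d q = -1 := by
    intro q hq
    rw [hS_def, Nat.mem_primeFactors] at hq
    obtain ⟨hqP, hqD, -⟩ := hq
    have hqℓ : q ≠ (cmFieldDiscrOfJ W.j).natAbs := by
      rintro rfl
      exact not_dvd_discr_of_satisfiesHeegnerHypothesis hK hH hℓP hℓN (Int.natCast_dvd.mpr hqD)
    rcases jacobiSym.trichotomy d q with h0 | h1 | h2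
    · exfalso
      haveI : NeZero q := ⟨hqP.ne_zero⟩
      have hgcd := (jacobiSym.eq_zero_iff_not_coprime).mp h0
      apply hgcd
      rw [hdℓ, Int.gcd, Int.natAbs_neg, Int.natAbs_natCast, Int.natAbs_natCast]
      exact (Nat.coprime_primes hℓP hqP).mpr (Ne.symm hqℓ)
    · exact Or.inl h1
    · exact Or.inr h2
  -- a product of signs equal to `−1` has an odd number of `−1`'s
  have hsplit := Finset.prod_filter_mul_prod_filter_not S (fun q ↦ jacobiSym d q = -1) (fun q ↦ jacobiSym d q)
  have hneg : ∏ q ∈ S.filter (fun q ↦ jacobiSym d q = -1), jacobiSym d q =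
      (-1) ^ (S.filter (fun q ↦ jacobiSym d q = -1)).card := by
    rw [Finset.prod_congr rfl (fun q hq ↦ (Finset.mem_filter.mp hq).2), Finset.prod_const]
  have hpos : ∏ q ∈ S.filter (fun q ↦ ¬ jacobiSym d q = -1), jacobiSym d q = 1 := by
    refine Finset.prod_eq_one fun q hq ↦ ?_
    obtain ⟨hqS, hq1⟩ := Finset.mem_filter.mp hq
    exact (hpm q hqS).resolve_right hq1
  rw [hneg, hpos, mul_one, hprod] at hsplit
  by_contra hev
  rw [Nat.not_odd_iff_even] at hev
  rw [hev.neg_one_pow] at hsplit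
  norm_num at hsplit

/-! ## Append 1 (same seat): the counting form WITHOUT the `ρ̄₂`-onto binder (the pen's typed `OddInertCountOnHTwo` verbatim) -/

/-- **The CM prime `ℓ = |d_F|` divides the conductor for EVERY CM curve with `2` inert in `F`** (no image hypothesis): `ℓ` is odd and
`ℓ ∣ d_F`, so `W` is bad at `ℓ` (tree `X12.not_good_of_hasCM_of_dvd_cmFieldDiscrOfJ`: CM curves are bad at the odd primes ramified in the
CM field) and `ℓ ∣ N_W`. [cite: SilvermanAEC2009, Cor. VII.7.2] -/
theorem natAbs_cmFieldDiscr_dvd_conductorNorm_of_hasCM (W : WeierstrassCurve ℚ) [W.IsElliptic] [W.IsGloballyMinimal]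
    (hCM : W.HasCM) (hin : CMInert W 2) : (cmFieldDiscrOfJ W.j).natAbs ∣ W.conductorNorm ℤ := by
  obtain ⟨hℓP, hℓ4, hdℓ⟩ := ShaCountTwo.prime_natAbs_cmFieldDiscr_of_cmInert_two W hin
  haveI : Fact (cmFieldDiscrOfJ W.j).natAbs.Prime := ⟨hℓP⟩
  have hℓ2 : (cmFieldDiscrOfJ W.j).natAbs ≠ 2 := by omega
  have hdvd : ((cmFieldDiscrOfJ W.j).natAbs : ℤ) ∣ cmFieldDiscrOfJ W.j := by
    rw [hdℓ]
    simp
  rw [W.dvd_conductorNorm_iff_not_hasGoodReductionAtPrime]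
  exact Summit.BirchSwinnertonDyer.Rank1Residual.X12.not_good_of_hasCM_of_dvd_cmFieldDiscrOfJ W hCM _ hℓ2 hdvd

/-- **`(d_F / |d_K|) = −1`, image-free form** (only `HasCM`, `CMInert W 2`, `K` imaginary quadratic with odd `d_K` and the Heegner hypothesis).
[cite: GrossLMS1991, §2 (Heegner hypothesis)] -/
theorem jacobiSym_cmFieldDiscr_natAbs_discr_eq_neg_one' (W : WeierstrassCurve ℚ) [W.IsElliptic] [W.IsGloballyMinimal]
    (hCM : W.HasCM) (hin : CMInert W 2)
    (K : Type) [Field K] [NumberField K] (hK : IsImaginaryQuadratic K) (hodd : Odd (NumberField.discr K))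
    (hH : SatisfiesHeegnerHypothesis (W.conductorNorm ℤ) K) :
    jacobiSym (cmFieldDiscrOfJ W.j) (NumberField.discr K).natAbs = -1 := by
  obtain ⟨hℓP, hℓ4, hdℓ⟩ := ShaCountTwo.prime_natAbs_cmFieldDiscr_of_cmInert_two W hin
  have hℓN := natAbs_cmFieldDiscr_dvd_conductorNorm_of_hasCM W hCM hin
  set ℓ : ℕ := (cmFieldDiscrOfJ W.j).natAbs with hℓ_def
  set D : ℤ := NumberField.discr K with hD_def
  have hDneg : D < 0 := IsImaginaryQuadratic.discr_neg hK
  have hD4 : D % 4 = 1 := Literature.NumberTheory.QuadraticFields.Quadratic.discr_emod_four_eq_one hK.1 hodd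
  have hDabs : (D.natAbs : ℤ) = -D := by omega
  have hm4 : D.natAbs % 4 = 3 := by omega
  have hℓ2 : ℓ ≠ 2 := by omega
  have hkr := ((satisfiesHeegnerHypothesis_iff_kronecker (W.conductorNorm ℤ) K hK.1).mp hH ℓ hℓP hℓN).2 hℓ2
  have hrec : jacobiSym (ℓ : ℤ) D.natAbs = -jacobiSym (D.natAbs : ℤ) ℓ :=
    jacobiSym.quadratic_reciprocity_three_mod_four hℓ4 hm4
  have hDℓ : jacobiSym (D.natAbs : ℤ) ℓ = -1 := by
    rw [hDabs, jacobiSym.neg _ (Nat.odd_iff.mpr (by omega)), ZMod.χ₄_nat_three_mod_four hℓ4, hkr]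
    norm_num
  rw [hdℓ, jacobiSym.neg _ (Nat.odd_iff.mpr (by omega)), ZMod.χ₄_nat_three_mod_four hm4, hrec, hDℓ]
  norm_num

/-- **Genus parity on H₂, counting form, image-free — the pen's `OddInertCountOnHTwo` VERBATIM**: for `W/ℚ` globally minimal with CM and `2`
inert in `F`, every imaginary quadratic `K` with odd `d_K` and the Heegner hypothesis has an ODD number of prime factors `q ∣ d_K` with
`(d_F/q) = −1`. [cite: GrossLMS1991, §2 (Heegner hypothesis)] -/
theorem oddInertCountOnHTwo' :
    ∀ (W : WeierstrassCurve ℚ) [W.IsElliptic] [W.IsGloballyMinimal] [NeZero (W.conductorNorm ℤ)],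
      W.HasCM → CMInert W 2 →
      ∀ (K : Type) [Field K] [NumberField K], IsImaginaryQuadratic K → Odd (NumberField.discr K) →
        SatisfiesHeegnerHypothesis (W.conductorNorm ℤ) K →
        Odd (((NumberField.discr K).natAbs.primeFactors.filter
                (fun q => jacobiSym (cmFieldDiscrOfJ W.j) q = -1)).card) := by
  intro W _ _ _ hCM hin K _ _ hK hodd hH
  obtain ⟨hℓP, hℓ4, hdℓ⟩ := ShaCountTwo.prime_natAbs_cmFieldDiscr_of_cmInert_two W hin
  have hℓN := natAbs_cmFieldDiscr_dvd_conductorNorm_of_hasCM W hCM hin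
  set d : ℤ := cmFieldDiscrOfJ W.j with hd_def
  set D : ℤ := NumberField.discr K with hD_def
  set S := D.natAbs.primeFactors with hS_def
  have hsqf : Squarefree D.natAbs := by
    rcases Literature.NumberTheory.QuadraticFields.Quadratic.isFundamentalDiscriminant_discr hK.1 with ⟨-, hsq, -⟩ | ⟨h4, -, -⟩
    · exact Int.squarefree_natAbs.mpr hsq
    · exfalso
      rw [Int.odd_iff] at hodd
      omega
  have hprod : ∏ q ∈ S, jacobiSym d q = -1 := by
    rw [← jacobiSym_eq_prod_primeFactors_of_squarefree d hsqf]
    exact jacobiSym_cmFieldDiscr_natAbs_discr_eq_neg_one' W hCM hin K hK hodd hH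
  have hpm : ∀ q ∈ S, jacobiSym d q = 1 ∨ jacobiSym d q = -1 := by
    intro q hq
    rw [hS_def, Nat.mem_primeFactors] at hq
    obtain ⟨hqP, hqD, -⟩ := hq
    have hqℓ : q ≠ (cmFieldDiscrOfJ W.j).natAbs := by
      rintro rfl
      exact not_dvd_discr_of_satisfiesHeegnerHypothesis hK hH hℓP hℓN (Int.natCast_dvd.mpr hqD)
    rcases jacobiSym.trichotomy d q with h0 | h1 | h2
    · exfalso
      haveI : NeZero q := ⟨hqP.ne_zero⟩
      have hgcd := (jacobiSym.eq_zero_iff_not_coprime).mp h0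
      apply hgcd
      rw [hdℓ, Int.gcd, Int.natAbs_neg, Int.natAbs_natCast, Int.natAbs_natCast]
      exact (Nat.coprime_primes hℓP hqP).mpr (Ne.symm hqℓ)
    · exact Or.inl h1
    · exact Or.inr h2
  have hsplit := Finset.prod_filter_mul_prod_filter_not S (fun q ↦ jacobiSym d q = -1) (fun q ↦ jacobiSym d q)
  have hneg : ∏ q ∈ S.filter (fun q ↦ jacobiSym d q = -1), jacobiSym d q =
      (-1) ^ (S.filter (fun q ↦ jacobiSym d q = -1)).card := by
    rw [Finset.prod_congr rfl (fun q hq ↦ (Finset.mem_filter.mp hq).2), Finset.prod_const]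
  have hpos : ∏ q ∈ S.filter (fun q ↦ ¬ jacobiSym d q = -1), jacobiSym d q = 1 := by
    refine Finset.prod_eq_one fun q hq ↦ ?_
    obtain ⟨hqS, hq1⟩ := Finset.mem_filter.mp hq
    exact (hpm q hqS).resolve_right hq1
  rw [hneg, hpos, mul_one, hprod] at hsplit
  by_contra hev
  rw [Nat.not_odd_iff_even] at hev
  rw [hev.neg_one_pow] at hsplit
  norm_num at hsplit

end Summit.BirchSwinnertonDyer.BirchSwinnertonDyer.Theorems.GenusParityTwo

end
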